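import Summits.AtomisticToContinuum.FouriersLaw.Theorems.VanishingNoiseTransferNoiseLocalityStubResponseDensityNoisyDyson3
import Summits.AtomisticToContinuum.FouriersLaw.Theorems.VanishingNoiseTransferNoiseLocalityStubResponseDensityNoisyDyson4
import Summits.AtomisticToContinuum.FouriersLaw.Theorems.VanishingNoiseTransferNoiseLocalityStubResponseDensityNoisyDyson11

/-!
# Flip-noisy response density, step 7: the Poisson equation of the embedded flip chain, and the
Gibbs form of the resolvent response identity (helpers for stub `stub_responseDensityNoisy`)

Helper file `--supports stmt-AtomisticToContinuum-11975` (crux `NoiseLocality`, route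
`VanishingNoiseTransfer`, line `relative-flip-energy-transfer`, stub 1b `stub_responseDensityNoisy`),
namespace `…NoiseLocality.StubResponseDensityNoisy.Dyson`.

* `poisson_of_geometric` — ABSTRACT: for a Markov kernel `P` and a probability measure `π` with a
  geometric bound `|Pⁿφ(x) - π(φ)| ≤ C_g ᾱⁿ M W(x)` for `|φ| ≤ M W` (`ᾱ < 1`, `W ≥ 1`), the Neumann
  series `χ = ∑ₙ (Pⁿψ - π(ψ))` of a `W`-bounded measurable `ψ` converges, is measurable,
  `|χ| ≤ C_g M W/(1-ᾱ)`, and solves the POISSON EQUATION `χ - Pχ = ψ - π(ψ)`;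
* `poisson_embeddedFlipKernel` — the same for the embedded flip chain `K` of the pinned chain with
  baths in `[T/2, 2T]`, an invariant probability measure `π` of `K` and a CONTINUOUS `ψ` with
  `|ψ| ≤ M e^{ϑH}`: `χ` is moreover continuous (locally uniform convergence, `…Dyson3`), with
  constants uniform in the temperatures (`…Dyson2`);
* `rri_gibbs` — `π_T(R_r F) - π_T(F) = δ (γ/2T²) r⁻¹ π_T((p_0² - p_{N-1}²) · R_r F)` for continuous
  `|F| ≤ C e^{ϑH}` and baths at `T ± δ/2` (`…Dyson4` divided by the partition function, `…Dyson11`).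

No definitions.
-/

noncomputable section

open MeasureTheory ProbabilityTheory Filter Topology Set
open scoped NNReal ENNReal

namespace Summit.AtomisticToContinuum.FouriersLaw.Theorems.NoiseLocality.StubResponseDensityNoisy.Dyson

open Literature.MathematicalPhysics.KineticTheory.HeatConduction
open Literature.Probability.Process Literature.MathematicalPhysics.KineticTheory OscillatorChain

/-! ### The Poisson equation of a geometrically ergodic kernel (abstract) -/

section Poisson

variable {X : Type*} [MeasurableSpace X]

/-- **The Neumann series solves the Poisson equation.** Let `P` be a Markov kernel, `π` an
invariant... more precisely ANY probability measure, `W ≥ 1` a weight integrable against every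
`Pⁿ(x, ·)`, and suppose the geometric bound `|Pⁿφ(x) - π(φ)| ≤ C_g ᾱⁿ M W(x)` for all measurable
`|φ| ≤ M W` (`0 ≤ ᾱ < 1`). Then for measurable `|ψ| ≤ M W` the series
`χ(x) = ∑ₙ (Pⁿψ(x) - π(ψ))` converges absolutely, `χ` is measurable, `|χ| ≤ C_g M W/(1-ᾱ)`, and
`χ(x) - Pχ(x) = ψ(x) - π(ψ)`. -/
theorem poisson_of_geometric (P : Kernel X X) [IsMarkovKernel P] (π : Measure X)
    [IsProbabilityMeasure π] {W : X → ℝ} (hW1 : ∀ x, 1 ≤ W x)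
    (hWP : ∀ (n : ℕ) (x : X), Integrable W ((P ^ n) x))
    {abar Cg : ℝ} (h0 : 0 ≤ abar) (h1 : abar < 1) (hCg : 0 ≤ Cg)
    (hgeo : ∀ (n : ℕ) (φ : X → ℝ), Measurable φ → ∀ M : ℝ, 0 ≤ M → (∀ x, |φ x| ≤ M * W x) →
      ∀ x, |(∫ y, φ y ∂((P ^ n) x)) - ∫ y, φ y ∂π| ≤ Cg * abar ^ n * M * W x)
    {ψ : X → ℝ} (hψm : Measurable ψ) {M : ℝ} (hM : 0 ≤ M) (hψ : ∀ x, |ψ x| ≤ M * W x) :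
    (∀ x, Summable fun n : ℕ => (∫ y, ψ y ∂((P ^ n) x)) - ∫ y, ψ y ∂π) ∧
    (Measurable fun x => ∑' n : ℕ, ((∫ y, ψ y ∂((P ^ n) x)) - ∫ y, ψ y ∂π)) ∧
    (∀ x, |∑' n : ℕ, ((∫ y, ψ y ∂((P ^ n) x)) - ∫ y, ψ y ∂π)| ≤ Cg / (1 - abar) * M * W x) ∧
    ∀ x, (∑' n : ℕ, ((∫ y, ψ y ∂((P ^ n) x)) - ∫ y, ψ y ∂π)) -
        ∫ z, (∑' n : ℕ, ((∫ y, ψ y ∂((P ^ n) z)) - ∫ y, ψ y ∂π)) ∂(P x) =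
      ψ x - ∫ y, ψ y ∂π := by
  haveI : ∀ n, IsMarkovKernel (P ^ n) := fun n => Harris.isMarkovKernel_pow P n
  set f : ℕ → X → ℝ := fun n x => (∫ y, ψ y ∂((P ^ n) x)) - ∫ y, ψ y ∂π with hf
  have h1' : 0 < 1 - abar := by linarith
  -- termwise bound and measurability
  have hfb : ∀ n x, |f n x| ≤ Cg * abar ^ n * M * W x := fun n x => hgeo n ψ hψm M hM hψ x
  have hfm : ∀ n, Measurable (f n) := fun n =>
    ((hψm.stronglyMeasurable.integral_kernel (κ := P ^ n)).measurable).sub measurable_const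
  have hgeom : Summable fun n : ℕ => abar ^ n := summable_geometric_of_lt_one h0 h1
  have hsum : ∀ x, Summable fun n => f n x := fun x =>
    Summable.of_norm_bounded (g := fun n => Cg * abar ^ n * M * W x)
      ((hgeom.mul_left (Cg * M * W x)).congr fun n => by ring) fun n => by
      rw [Real.norm_eq_abs]; exact hfb n x
  have hgeomW : ∀ x, Summable fun n : ℕ => Cg * abar ^ n * M * W x := fun x =>
    (hgeom.mul_left (Cg * M * W x)).congr fun n => by ring
  have htsum_bound : ∀ x, |∑' n, f n x| ≤ Cg / (1 - abar) * M * W x := by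
    intro x
    calc |∑' n, f n x| ≤ ∑' n, |f n x| := by
          rw [← Real.norm_eq_abs]
          refine (norm_tsum_le_tsum_norm ?_).trans (le_of_eq ?_)
          · simpa only [Real.norm_eq_abs] using (hsum x).abs
          · simp only [Real.norm_eq_abs]
      _ ≤ ∑' n : ℕ, Cg * abar ^ n * M * W x :=
          ((hsum x).abs).tsum_le_tsum (fun n => hfb n x) (hgeomW x)
      _ = Cg * M * W x * ∑' n : ℕ, abar ^ n := by
          rw [← tsum_mul_left]; exact tsum_congr fun n => by ring
      _ = Cg / (1 - abar) * M * W x := by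
          rw [tsum_geometric_of_lt_one h0 h1]; field_simp
  -- measurability of the sum (limit of the partial sums)
  have hmeas : Measurable fun x => ∑' n, f n x := by
    refine measurable_of_tendsto_metrizable (f := fun m x => ∑ n ∈ Finset.range m, f n x)
      (fun m => Finset.measurable_sum _ fun n _ => hfm n) ?_
    rw [tendsto_pi_nhds]
    exact fun x => (hsum x).hasSum.tendsto_sum_nat
  refine ⟨hsum, hmeas, htsum_bound, fun x => ?_⟩
  -- the Poisson equation: `P (∑ₙ fₙ) = ∑ₙ P fₙ = ∑ₙ fₙ₊₁`
  have hWPx : Integrable W (P x) := by simpa using hWP 1 x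
  have hfint : ∀ n, Integrable (f n) (P x) := fun n =>
    (hWPx.const_mul (Cg * abar ^ n * M)).mono' (hfm n).aestronglyMeasurable
      (Eventually.of_forall fun z => by rw [Real.norm_eq_abs]; exact hfb n z)
  have hPf : ∀ n, ∫ z, f n z ∂(P x) = f (n + 1) x := by
    intro n
    have hψint : Integrable ψ ((P ^ (n + 1)) x) :=
      ((hWP (n + 1) x).const_mul M).mono' hψm.aestronglyMeasurable
        (Eventually.of_forall fun z => by rw [Real.norm_eq_abs]; exact hψ z)
    rw [Harris.pow_succ_eq_comp, Kernel.comp_apply] at hψint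
    have hcomp := Harris.integral_comp_measure (P ^ n) (P x) hψint
    have hg' : Integrable (fun z => f n z + ∫ y, ψ y ∂π) (P x) := (hfint n).add (integrable_const _)
    have hg : Integrable (fun z => ∫ y, ψ y ∂((P ^ n) z)) (P x) := by
      refine hg'.congr (Eventually.of_forall fun z => ?_)
      simp only [hf, sub_add_cancel]
    simp only [hf]
    rw [integral_sub hg (integrable_const _), integral_const, probReal_univ, one_smul, ← hcomp,
      Harris.pow_succ_eq_comp, Kernel.comp_apply]
  -- summability of the `L¹(P x)` norms, for `integral_tsum`
  have hL1 : ∀ n, ∫⁻ a, ‖f n a‖ₑ ∂(P x) ≤ ENNReal.ofReal (Cg * abar ^ n * M * ∫ a, W a ∂(P x)) := by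
    intro n
    calc ∫⁻ a, ‖f n a‖ₑ ∂(P x) ≤ ∫⁻ a, ENNReal.ofReal (Cg * abar ^ n * M * W a) ∂(P x) :=
          lintegral_mono fun a => by
            rw [Real.enorm_eq_ofReal_abs]; exact ENNReal.ofReal_le_ofReal (hfb n a)
      _ = ENNReal.ofReal (∫ a, Cg * abar ^ n * M * W a ∂(P x)) :=
          (ofReal_integral_eq_lintegral_ofReal (hWPx.const_mul _) (Eventually.of_forall fun a =>
            by have := hW1 a; positivity)).symm
      _ = _ := by rw [integral_const_mul]
  have hI0 : 0 ≤ ∫ a, W a ∂(P x) := integral_nonneg fun a => zero_le_one.trans (hW1 a)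
  have hsumI : Summable fun n : ℕ => Cg * abar ^ n * M * ∫ a, W a ∂(P x) :=
    (hgeom.mul_left (Cg * M * ∫ a, W a ∂(P x))).congr fun n => by ring
  have hne : ∑' n, ∫⁻ a, ‖f n a‖ₑ ∂(P x) ≠ ⊤ := by
    refine ne_top_of_le_ne_top ?_ (ENNReal.tsum_le_tsum hL1)
    rw [← ENNReal.ofReal_tsum_of_nonneg (fun n => by positivity) hsumI]
    exact ENNReal.ofReal_ne_top
  have htsumP : ∫ z, (∑' n, f n z) ∂(P x) = ∑' n, f (n + 1) x := by
    rw [integral_tsum (fun n => (hfm n).aestronglyMeasurable) hne]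
    exact tsum_congr hPf
  have h0x : f 0 x = ψ x - ∫ y, ψ y ∂π := by
    simp only [hf]
    rw [Harris.pow_zero_apply, integral_dirac' _ _ hψm.stronglyMeasurable]
  change (∑' n, f n x) - ∫ z, (∑' n, f n z) ∂(P x) = ψ x - ∫ y, ψ y ∂π
  rw [htsumP, (hsum x).tsum_eq_zero_add, h0x]
  ring

end Poisson

/-! ### Gibbs-measure identities -/

section Gibbs

variable {N : ℕ} {ω₂ lam β γ : ℝ} (hω : 0 < ω₂) (hl : 0 < lam) (hβ : 0 < β) (hγ : 0 < γ) (hN : 0 < N)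
  {T : ℝ} (hT : 0 < T) {ϑ : ℝ} (hϑ : 0 < ϑ) (hϑT : ϑ < 1 / (2 * T)) {δ : ℝ} (hδ : |δ| < T)
  {r : ℝ} (hr : 0 < r)
include hω hl hβ hγ hN hT hϑ hϑT hδ hr

/-- **The resolvent response identity against the Gibbs measure**: for continuous `F` with
`|F| ≤ C e^{ϑH}` and baths at `T ± δ/2` (`|δ| < T`),
`π_T(R_r F) - π_T(F) = δ (γ/2T²) r⁻¹ π_T((p_0² - p_{N-1}²) · R_r F)` (`…Dyson4` divided by `Z`). -/
theorem rri_gibbs {F : PhaseSpace N → ℝ} (hF : Continuous F) {C : ℝ}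
    (hFb : ∀ y, |F y| ≤ C * Real.exp (ϑ * (pinnedChain ω₂ lam β γ).hamiltonian N y)) :
    (∫ x, (∫ y, F y ∂((pinnedChainSemigroup hω hl.le hβ.le hγ.le hN (bath_window hT hδ).1.le
        (bath_window hT hδ).2.2.1.le).resolventKernel r x)) ∂((pinnedChain ω₂ lam β γ).gibbsMeasure N T)) -
      ∫ x, F x ∂((pinnedChain ω₂ lam β γ).gibbsMeasure N T) =
      δ * (γ / (2 * T ^ 2)) * r⁻¹ *
        ∫ x, (x.2 ⟨0, hN⟩ ^ 2 - x.2 ⟨N - 1, by omega⟩ ^ 2) *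
          (∫ y, F y ∂((pinnedChainSemigroup hω hl.le hβ.le hγ.le hN (bath_window hT hδ).1.le
            (bath_window hT hδ).2.2.1.le).resolventKernel r x)) ∂((pinnedChain ω₂ lam β γ).gibbsMeasure N T) := by
  have h := resolvent_response_identity hω hl hβ hγ hN hT hϑ hϑT hδ hr hF hFb
  rw [integral_gibbs_eq, integral_gibbs_eq, integral_gibbs_eq, ← mul_sub, h]
  have e : ∀ x : PhaseSpace N, Real.exp (-1 / T * (pinnedChain ω₂ lam β γ).hamiltonian N x) *
      ((x.2 ⟨0, hN⟩ ^ 2 - x.2 ⟨N - 1, by omega⟩ ^ 2) *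
        ∫ y, F y ∂((pinnedChainSemigroup hω hl.le hβ.le hγ.le hN (bath_window hT hδ).1.le
          (bath_window hT hδ).2.2.1.le).resolventKernel r x)) =
      (∫ y, F y ∂((pinnedChainSemigroup hω hl.le hβ.le hγ.le hN (bath_window hT hδ).1.le
          (bath_window hT hδ).2.2.1.le).resolventKernel r x)) *
        (Real.exp (-1 / T * (pinnedChain ω₂ lam β γ).hamiltonian N x) *
          (x.2 ⟨0, hN⟩ ^ 2 - x.2 ⟨N - 1, by omega⟩ ^ 2)) := fun x => by ring
  simp_rw [e]
  ring

end Gibbs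

/-! ### The Poisson equation of the embedded flip chain -/

section PoissonK

variable {N : ℕ} {ω₂ lam β γ : ℝ} (hω : 0 < ω₂) (hl : 0 < lam) (hβ : 0 < β) (hγ : 0 < γ) (hN : 0 < N)
  {T : ℝ} (hT : 0 < T) {ϑ : ℝ} (hϑ : 0 < ϑ) (h2ϑT : 2 * ϑ < 1 / (2 * T)) {r : ℝ} (hr : 0 < r)
include hω hl hβ hγ hN hT hϑ h2ϑT hr

/-- **The Poisson equation of the embedded flip chain, with constants uniform in the temperatures.**
There are `ᾱ ∈ (0,1)`, `C_π, C_g ≥ 0` such that for all baths `T_L, T_R ∈ [T/2, 2T]`, every invariant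
probability measure `π` of `K = Q ∘ₖ R_r` and every CONTINUOUS `ψ` with `|ψ| ≤ M e^{ϑH}` (`M ≥ 0`):
`∫ e^{ϑH} dπ ≤ C_π`; `|Kⁿψ(x) - π(ψ)| ≤ C_g ᾱⁿ M e^{ϑH(x)}`; the Neumann series
`χ = ∑ₙ (Kⁿψ - π(ψ))` converges, is continuous, `|χ| ≤ C_g M e^{ϑH}/(1-ᾱ)`, and `χ - Kχ = ψ - π(ψ)`. -/
theorem poisson_embeddedFlipKernel :
    ∃ abar Cπ Cg : ℝ, 0 < abar ∧ abar < 1 ∧ 0 ≤ Cπ ∧ 0 ≤ Cg ∧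
      ∀ (T_L T_R : ℝ) (hL : T / 2 ≤ T_L) (_hL' : T_L ≤ 2 * T) (hR : T / 2 ≤ T_R) (_hR' : T_R ≤ 2 * T)
        (π : Measure (PhaseSpace N)), IsProbabilityMeasure π →
        Kernel.Invariant ((pinnedChainSemigroup hω hl.le hβ.le hγ.le hN ((half_pos hT).le.trans hL)
          ((half_pos hT).le.trans hR)).embeddedFlipKernel r) π →
        (∫⁻ x, ENNReal.ofReal (Real.exp (ϑ * (pinnedChain ω₂ lam β γ).hamiltonian N x)) ∂π ≤ ENNReal.ofReal Cπ) ∧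
        ∀ (ψ : PhaseSpace N → ℝ), Continuous ψ → ∀ M : ℝ, 0 ≤ M →
          (∀ x, |ψ x| ≤ M * Real.exp (ϑ * (pinnedChain ω₂ lam β γ).hamiltonian N x)) →
          (∀ (n : ℕ) (x : PhaseSpace N), |(∫ y, ψ y ∂((((pinnedChainSemigroup hω hl.le hβ.le hγ.le hN
              ((half_pos hT).le.trans hL) ((half_pos hT).le.trans hR)).embeddedFlipKernel r) ^ n) x)) - ∫ y, ψ y ∂π| ≤
              Cg * abar ^ n * M * Real.exp (ϑ * (pinnedChain ω₂ lam β γ).hamiltonian N x)) ∧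
          (∀ x, Summable fun n : ℕ => (∫ y, ψ y ∂((((pinnedChainSemigroup hω hl.le hβ.le hγ.le hN
              ((half_pos hT).le.trans hL) ((half_pos hT).le.trans hR)).embeddedFlipKernel r) ^ n) x)) - ∫ y, ψ y ∂π) ∧
          (Continuous fun x => ∑' n : ℕ, ((∫ y, ψ y ∂((((pinnedChainSemigroup hω hl.le hβ.le hγ.le hN
              ((half_pos hT).le.trans hL) ((half_pos hT).le.trans hR)).embeddedFlipKernel r) ^ n) x)) - ∫ y, ψ y ∂π)) ∧
          (∀ x, |∑' n : ℕ, ((∫ y, ψ y ∂((((pinnedChainSemigroup hω hl.le hβ.le hγ.le hN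
              ((half_pos hT).le.trans hL) ((half_pos hT).le.trans hR)).embeddedFlipKernel r) ^ n) x)) - ∫ y, ψ y ∂π)| ≤
              Cg / (1 - abar) * M * Real.exp (ϑ * (pinnedChain ω₂ lam β γ).hamiltonian N x)) ∧
          ∀ x, (∑' n : ℕ, ((∫ y, ψ y ∂((((pinnedChainSemigroup hω hl.le hβ.le hγ.le hN
              ((half_pos hT).le.trans hL) ((half_pos hT).le.trans hR)).embeddedFlipKernel r) ^ n) x)) - ∫ y, ψ y ∂π)) -
            ∫ z, (∑' n : ℕ, ((∫ y, ψ y ∂((((pinnedChainSemigroup hω hl.le hβ.le hγ.le hN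
              ((half_pos hT).le.trans hL) ((half_pos hT).le.trans hR)).embeddedFlipKernel r) ^ n) z)) - ∫ y, ψ y ∂π))
              ∂((pinnedChainSemigroup hω hl.le hβ.le hγ.le hN ((half_pos hT).le.trans hL)
                ((half_pos hT).le.trans hR)).embeddedFlipKernel r x) = ψ x - ∫ y, ψ y ∂π := by
  set Pc := pinnedChain ω₂ lam β γ with hPc
  have hHc : Continuous (Pc.hamiltonian N) := pinnedChain_continuous_hamiltonian ω₂ lam β γ N
  have hϑT : ϑ < 1 / (2 * T) := theta_lt_of_two_theta_lt hϑ h2ϑT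
  obtain ⟨abar, Cπ, Cg, h0, h1, hCπ, hCg, hH⟩ := harris_embeddedFlipKernel_unif hω hl hβ hγ hN hT hϑ hϑT hr
  obtain ⟨Cp, hCp, hpow⟩ := lintegral_exp_embeddedFlipKernel_pow_le_unif hω hl hβ hγ hN hT hϑ hϑT hr
  refine ⟨abar, Cπ, Cg, h0, h1, hCπ, hCg, fun T_L T_R hL hL' hR hR' π hπ hinv => ?_⟩
  haveI := hπ
  have hL0 : 0 < T_L := (half_pos hT).trans_le hL
  have hR0 : 0 < T_R := (half_pos hT).trans_le hR
  set Sg := pinnedChainSemigroup hω hl.le hβ.le hγ.le hN ((half_pos hT).le.trans hL) ((half_pos hT).le.trans hR)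
    with hSg
  set K := Sg.embeddedFlipKernel r with hK
  haveI : IsMarkovKernel K := Sg.isMarkovKernel_embeddedFlipKernel hr
  obtain ⟨-, hmom⟩ := hH T_L T_R hL hL' hR hR'
  obtain ⟨hπV, hgeo⟩ := hmom π hπ hinv
  refine ⟨hπV, fun ψ hψ M hM hψb => ?_⟩
  -- the weight `W = e^{ϑH}`
  set W : PhaseSpace N → ℝ := fun x => Real.exp (ϑ * Pc.hamiltonian N x) with hW
  have hWm : Measurable W := (Real.continuous_exp.comp (continuous_const.mul hHc)).measurable
  have hW1 : ∀ x, 1 ≤ W x := fun x =>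
    Real.one_le_exp (mul_nonneg hϑ.le (pinnedChain_hamiltonian_nonneg hω.le hl.le hβ.le γ N x))
  have hWP : ∀ (n : ℕ) (x : PhaseSpace N), Integrable W ((K ^ n) x) := fun n x =>
    (integrable_abs_integral_le_of_lintegral_le hWm (fun z => (Real.exp_pos _).le)
      (ENNReal.add_ne_top.2 ⟨ENNReal.ofReal_ne_top, hCp⟩) (hpow T_L T_R hL0 hL' hR0 hR' n x)
      hWm.aestronglyMeasurable zero_le_one (fun z => by rw [one_mul, abs_of_pos (Real.exp_pos _)])).1
  obtain ⟨hsum, -, hbound, hpoisson⟩ := poisson_of_geometric K π hW1 hWP h0.le h1 hCg hgeo hψ.measurable hM hψb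
  refine ⟨fun n x => hgeo n ψ hψ.measurable M hM hψb x, hsum, ?_, hbound, hpoisson⟩
  -- continuity: locally uniform convergence, via the normalised terms
  have hwin : ∀ _y : Unit, 0 < T_L ∧ T_L ≤ 2 * T ∧ 0 < T_R ∧ T_R ≤ 2 * T := fun _ => ⟨hL0, hL', hR0, hR'⟩
  obtain ⟨_Cp', _hCp', hcontK⟩ := continuous_integral_embeddedFlipKernel_pow_param hω hl hβ hγ hN hT hϑ h2ϑT
    (Y := Unit) (τL := fun _ => T_L) (τR := fun _ => T_R) continuous_const continuous_const hwin hr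
  have hu : Continuous fun x : PhaseSpace N => ((), x) := (continuous_const (y := ())).prodMk continuous_id
  have hterm : ∀ n : ℕ, Continuous fun x => (∫ y, ψ y ∂((K ^ n) x)) - ∫ y, ψ y ∂π := by
    intro n
    have h := (hcontK (F := fun _ => ψ) (hψ.comp continuous_snd) hM (fun _ y => hψb y) n).2
    have h2 := h.comp hu
    exact h2.sub continuous_const
  set g : ℕ → PhaseSpace N → ℝ := fun n x => ((∫ y, ψ y ∂((K ^ n) x)) - ∫ y, ψ y ∂π) / W x with hg
  have hgc : ∀ n, Continuous (g n) := fun n =>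
    (hterm n).div (Real.continuous_exp.comp (continuous_const.mul hHc)) fun x => (Real.exp_pos _).ne'
  have hgb : ∀ n x, ‖g n x‖ ≤ Cg * M * abar ^ n := fun n x => by
    rw [Real.norm_eq_abs, hg]; dsimp only
    rw [abs_div, abs_of_pos (Real.exp_pos _), div_le_iff₀ (Real.exp_pos _)]
    exact (hgeo n ψ hψ.measurable M hM hψb x).trans (le_of_eq (by ring))
  have hgsum : Continuous fun x => ∑' n, g n x :=
    continuous_tsum hgc ((summable_geometric_of_lt_one h0.le h1).mul_left (Cg * M)) hgb
  have heq : (fun x => ∑' n : ℕ, ((∫ y, ψ y ∂((K ^ n) x)) - ∫ y, ψ y ∂π)) = fun x => W x * ∑' n, g n x := by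
    funext x
    rw [← tsum_mul_left]
    exact tsum_congr fun n => by rw [hg]; dsimp only; rw [mul_div_cancel₀ _ (Real.exp_pos _).ne']
  rw [heq]
  exact (Real.continuous_exp.comp (continuous_const.mul hHc)).mul hgsum

end PoissonK


/-- Registered helper sub-goal `helper_responseDensityNoisyDysonPoisson` of stmt-AtomisticToContinuum-11975
(fully quantified, notation-free one-line form of the main theorem of this file). -/
theorem helper_responseDensityNoisyDysonPoisson : ∀ (ω₂ lam β γ : ℝ) (hω : 0 < ω₂) (hl : 0 < lam) (hβ : 0 < β) (hγ : 0 < γ) (N : ℕ) (hN : 0 < N) (T : ℝ) (hT : 0 < T) (ϑ : ℝ) (hϑ : 0 < ϑ) (h2ϑT : 2 * ϑ < 1 / (2 * T)) (r : ℝ) (hr : 0 < r), ∃ abar Cπ Cg : ℝ, 0 < abar ∧ abar < 1 ∧ 0 ≤ Cπ ∧ 0 ≤ Cg ∧ ∀ (T_L T_R : ℝ) (hL : T / 2 ≤ T_L) (_hL' : T_L ≤ 2 * T) (hR : T / 2 ≤ T_R) (_hR' : T_R ≤ 2 * T) (π : MeasureTheory.Measure (Literature.MathematicalPhysics.KineticTheory.HeatConduction.PhaseSpace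 N)), MeasureTheory.IsProbabilityMeasure π → ProbabilityTheory.Kernel.Invariant ((Literature.MathematicalPhysics.KineticTheory.HeatConduction.pinnedChainSemigroup hω hl.le hβ.le hγ.le hN ((half_pos hT).le.trans hL) ((half_pos hT).le.trans hR)).embeddedFlipKernel r) π → (∫⁻ x, ENNReal.ofReal (Real.exp (ϑ * (Literature.MathematicalPhysics.KineticTheory.HeatConduction.pinnedChain ω₂ lam β γ).hamiltonian N x)) ∂π ≤ ENNReal.ofReal Cπ) ∧ ∀ (ψ : Literature.MathematicalPhysics.KineticTheory.HeatConduction.PhaseSpace N → ℝ), Continuous ψ → ∀ M : ℝ, 0 ≤ M → (∀ x, |ψ x| ≤ M * Real.exp (ϑ * (Literature.MathematicalPhysics.KineticTheory.HeatConduction.pinnedChain ω₂ lam β γ).hamiltonian N x)) → (∀ (n : ℕ) (x : Literature.MathematicalPhysics.KineticTheory.HeatConduction.PhaseSpace N), |(∫ y, ψ y ∂((((Literature.MathematicalPhysics.KineticTheory.HeatConduction.pinnedChainSemigroup hω hl.le hβ.le hγ.le hN ((half_pos hT).le.trans hL) ((half_pos hT).le.trans hR)).embeddedFlipKernel r) ^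 n) x)) - ∫ y, ψ y ∂π| ≤ Cg * abar ^ n * M * Real.exp (ϑ * (Literature.MathematicalPhysics.KineticTheory.HeatConduction.pinnedChain ω₂ lam β γ).hamiltonian N x)) ∧ (∀ x, Summable fun n : ℕ => (∫ y, ψ y ∂((((Literature.MathematicalPhysics.KineticTheory.HeatConduction.pinnedChainSemigroup hω hl.le hβ.le hγ.le hN ((half_pos hT).le.trans hL) ((half_pos hT).le.trans hR)).embeddedFlipKernel r) ^ n) x)) - ∫ y, ψ y ∂π) ∧ (Continuous fun x => ∑' n : ℕ, ((∫ y, ψ y ∂((((Literature.MathematicalPhysics.KineticTheory.HeatConduction.pinnedChainSemigroup hω hl.le hβ.le hγ.le hN ((half_pos hT).le.trans hL) ((half_pos hT).le.trans hR)).embeddedFlipKernel r) ^ n) x)) - ∫ y, ψ y ∂π)) ∧ (∀ x, |∑' n : ℕ, ((∫ y, ψ y ∂((((Literature.MathematicalPhysics.KineticTheory.HeatConduction.pinnedChainSemigroup hω hl.le hβ.le hγ.le hN ((half_pos hT).le.trans hL) ((half_pos hT).le.trans hR)).embeddedFlipKernel r) ^ n) x)) - ∫ y, ψ y ∂π)|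 ≤ Cg / (1 - abar) * M * Real.exp (ϑ * (Literature.MathematicalPhysics.KineticTheory.HeatConduction.pinnedChain ω₂ lam β γ).hamiltonian N x)) ∧ ∀ x, (∑' n : ℕ, ((∫ y, ψ y ∂((((Literature.MathematicalPhysics.KineticTheory.HeatConduction.pinnedChainSemigroup hω hl.le hβ.le hγ.le hN ((half_pos hT).le.trans hL) ((half_pos hT).le.trans hR)).embeddedFlipKernel r) ^ n) x)) - ∫ y, ψ y ∂π)) - ∫ z, (∑' n : ℕ, ((∫ y, ψ y ∂((((Literature.MathematicalPhysics.KineticTheory.HeatConduction.pinnedChainSemigroup hω hl.le hβ.le hγ.le hN ((half_pos hT).le.trans hL) ((half_pos hT).le.trans hR)).embeddedFlipKernel r) ^ n) z)) - ∫ y, ψ y ∂π)) ∂((Literature.MathematicalPhysics.KineticTheory.HeatConduction.pinnedChainSemigroup hω hl.le hβ.le hγ.le hN ((half_pos hT).le.trans hL) ((half_pos hT).le.trans hR)).embeddedFlipKernel r x) = ψ x - ∫ y, ψ y ∂π :=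
  fun _ _ _ _ hω hl hβ hγ _ hN _ hT _ hϑ h2ϑT _ hr => poisson_embeddedFlipKernel hω hl hβ hγ hN hT hϑ h2ϑT hr

end Summit.AtomisticToContinuum.FouriersLaw.Theorems.NoiseLocality.StubResponseDensityNoisy.Dyson

end
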